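import Summits.CriticalPhenomena.PercolationContinuityZ3.Theorems.PercNearOneGluingNoHeavyLowerTailQuantitativeCovDIsolatedFloor
import Summits.CriticalPhenomena.PercolationContinuityZ3.Theorems.PercNearOneGluingNoHeavyLowerTailQuantitativeGenZeroSet
import HarnessLib

/-!
# The master form (GEN) dominates the ISOLATED TOP-RELAY term of its explicit floor:
# `Sur_o(A) ≥ ∏_{e ∩ (A∖k) ≠ ∅}(1 − w_e) · Cov_{w_{A∖k}}(F(V 𝒞_k), 1{k ↔ o})`

Support file (`--supports stmt-CriticalPhenomena-4575`), prover seat `prim-rate-mine-2` (lane prim-rate, constants-miner (c), BENCH row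
M2-R50 (lower half) / M2-R43 (vi); `run/shared/lean/prim/prim-rate/prim-rate-mine-2/PROOFS.md` §P50).  No definitions, no named facts, no sorries; standard axioms.

The complete explicit GEN floor (`CSH.surplus_pos_iff_exists_compat_rank_genFloor_pos`, row M2-R43 (vi)) has three pieces; its third — the top
relay's isolated Harris term `∏_{e∩T≠∅}(1−w_e)·Cov_{w_T}(F̂_k(𝒞_k), 1{k↔o})`, `T = A ∖ k` — entered the kernel only through its ZERO SET (certificate
C3).  With the quantitative vdBHK floor `CSH.covD_ge_isolated` (row M2-R50, lower half) it becomes an honest INEQUALITY: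
* `CSH.surplus_ge_isolatedTop` — support-restricted non-degenerate weights, `A` with injective compatible rank and top relay `k`, `o ∉ A`, `F`
  monotone `≥ 0`: **`∏_{e : ∃ y ∈ A∖k, y ∈ e} (1 − w_e) · (∫_{k↔o} F̂_k dμ_{w_T} − (∫ F̂_k dμ_{w_T})·μ_{w_T}(k↔o)) ≤ surplus w A r F o`**
  (GEN peeling identity `CSH.surplus_peel_top`: `μ(D_k)·Sur = μ(D_k)·s5dMargin + covD + γ_k·μ(…)` with the other two pieces `≥ 0`
  (`CSH.surplus_pieces_nonneg`), `covD ≥ μ(D_k)·∏(1−w)·Cov_{w_T}` (`CSH.covD_ge_isolated`), and `μ(D_k) > 0`).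
Combined with the two-cylinder floor (`QuantHarris.cov_ge_prodPow_cyl_mul_jumps`) this is an explicit LOCAL constant for the top-relay witness,
completing the set: every piece of the GEN identity now carries an explicit floor in the kernel.
[cite: KozmaNitzan2024, Conj. 4 (p. 32), Lemma 2 (p. 6)] [cite: VandenbergHaggstromKahn2005, Thm. 1.3 (p. 6)] [cite: Harris1960, Lemma 4.1 (p. 16)]
-/

noncomputable section

namespace Summit.CriticalPhenomena.PercolationContinuityZ3.Theorems

open MeasureTheory Set Literature.Probability.LatticeModels Literature.Probability.Percolation
open scoped Classical
open KNPreFKG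

namespace CSH

variable {n : ℕ}

/-- **(GEN) dominates the isolated top-relay term.**  See the module docstring. [cite: KozmaNitzan2024, Conj. 4 (p. 32), Lemma 2 (p. 6)]
[cite: VandenbergHaggstromKahn2005, Thm. 1.3 (p. 6)] -/
theorem surplus_ge_isolatedTop (w : Sym2 (Fin n) → unitInterval) (E : Set (Sym2 (Fin n)))
    (hE0 : ∀ f, f ∉ E → (w f : ℝ) = 0) (hE1 : ∀ f ∈ E, 0 < (w f : ℝ) ∧ (w f : ℝ) < 1)
    (A : Finset (Fin n)) (r : Fin n → ℕ) (hr : Set.InjOn r ↑A) (k : Fin n) (hkA : k ∈ A) (hkmax : ∀ a ∈ A, r a ≤ r k)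
    (o : Fin n) (hoA : o ∉ A)
    (F : Set (Fin n) → ℝ) (hF : ∀ S S' : Set (Fin n), S ⊆ S' → F S ≤ F S') (hF0 : ∀ S : Set (Fin n), 0 ≤ F S)
    (hcompat : ∀ a ∈ A, ∀ a' ∈ A, r a < r a' →
      ∫ ω, F (openCluster ω a) ∂(prodBernoulli w) ≤ ∫ ω, F (openCluster ω a') ∂(prodBernoulli w)) :
    (∏ e ∈ Finset.univ.filter (fun e : Sym2 (Fin n) => ∃ y ∈ (↑(A.erase k) : Set (Fin n)), y ∈ e), (1 - (w e : ℝ))) *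
        ((∫ η in openConn k o, F {c | c = k ∨ ∃ e ∈ openEdgeCluster η k, c ∈ e}
            ∂(prodBernoulli fun e => if (∃ y ∈ (↑(A.erase k) : Set (Fin n)), y ∈ e) then (0 : unitInterval) else w e)) -
          (∫ η, F {c | c = k ∨ ∃ e ∈ openEdgeCluster η k, c ∈ e}
            ∂(prodBernoulli fun e => if (∃ y ∈ (↑(A.erase k) : Set (Fin n)), y ∈ e) then (0 : unitInterval) else w e)) *
            (prodBernoulli fun e => if (∃ y ∈ (↑(A.erase k) : Set (Fin n)), y ∈ e) then (0 : unitInterval) else w e).real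
              (openConn k o)) ≤
      surplus w A r F o := by
  have hkT : k ∉ (↑(A.erase k) : Set (Fin n)) := fun h => Finset.notMem_erase k A (Finset.mem_coe.1 h)
  have hw : ∀ g, w g < 1 := by
    intro g
    by_cases hg : g ∈ E
    · exact_mod_cast (hE1 g hg).2
    · exact_mod_cast (show (w g : ℝ) < 1 by rw [hE0 g hg]; norm_num)
  have hFk : Monotone (fun C : Set (Sym2 (Fin n)) => F {c | c = k ∨ ∃ e ∈ C, c ∈ e}) := by
    intro C C' hCC'
    refine hF _ _ fun c hc => ?_
    rcases hc with hc | ⟨e, he, hce⟩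
    · exact Or.inl hc
    · exact Or.inr ⟨e, hCC' he, hce⟩
  -- the quantitative vdBHK floor for the third piece
  have hcov := covD_ge_isolated w k (↑(A.erase k) : Set (Fin n)) hkT o (fun C => F {c | c = k ∨ ∃ e ∈ C, c ∈ e}) hFk (fun _ => hF0 _)
  -- the peeling identity and the two other nonnegative pieces
  obtain ⟨h1, h2, -⟩ := surplus_pieces_nonneg w E hE0 hE1 A r hr k hkA o hoA F hF hF0 hcompat
  have hid := surplus_peel_top w hw A r F o k hkA hr hkmax
  have hempty : (∅ : BondConfig (Fin n)) ∈
      {ω : BondConfig (Fin n) | ∀ b ∈ (↑(A.erase k) : Set (Fin n)), ¬ (openGraph ω).Reachable k b} := by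
    intro b hb h
    rw [HullPort.reachable_empty_iff] at h
    subst h
    exact (Finset.notMem_erase k A) (Finset.mem_coe.1 hb)
  have hDpos : 0 < (prodBernoulli w).real {ω : BondConfig (Fin n) | ∀ b ∈ (↑(A.erase k) : Set (Fin n)), ¬ (openGraph ω).Reachable k b} :=
    prodBernoulli_real_pos_of_empty_mem w hw hempty
  -- `covD ≤ μ(D_k)·Sur` from the identity, then cancel `μ(D_k) > 0`
  have hle : covD w k (↑(A.erase k) : Set (Fin n)) (fun C => F {c | c = k ∨ ∃ e ∈ C, c ∈ e}) o ≤
      (prodBernoulli w).real {ω : BondConfig (Fin n) | ∀ b ∈ (↑(A.erase k) : Set (Fin n)), ¬ (openGraph ω).Reachable k b} * surplus w A r F o := by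
    rw [hid]
    nlinarith [mul_nonneg hDpos.le h1, mul_nonneg h2 (measureReal_nonneg :
      0 ≤ (prodBernoulli w).real ({ω : BondConfig (Fin n) | ∀ b ∈ (↑(A.erase k) : Set (Fin n)), ¬ (openGraph ω).Reachable k b} ∩ openConn o k))]
  have h3 := hcov.trans hle
  rw [mul_assoc] at h3
  refine le_of_mul_le_mul_left ?_ hDpos
  convert h3 using 9

end CSH

end Summit.CriticalPhenomena.PercolationContinuityZ3.Theorems

end
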